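import Mathlib
import Summits.Ventures.PercRepro2.Defs
import Summits.Ventures.PercRepro2.Graph
import Summits.Ventures.PercRepro2.Harris
import Summits.Ventures.PercRepro2.Events
import Summits.Ventures.PercRepro2.Independence
import Summits.Ventures.PercRepro2.Induced
import Summits.Ventures.PercRepro2.Exploration
import Summits.Ventures.PercRepro2.GateDefs
import Summits.Ventures.PercRepro2.GateAnatomy
import Summits.Ventures.PercRepro2.GateForest
import Summits.Ventures.PercRepro2.GateLSM
import Summits.Ventures.PercRepro2.GateSplit
import Summits.Ventures.PercRepro2.GateSplitForest
import Summits.Ventures.PercRepro2.HullTree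
import Summits.Ventures.PercRepro2.GateFeedbackForest
import Summits.Ventures.PercRepro2.GateFeedback
import Summits.Ventures.PercRepro2.GateFeedbackGeneral
import Summits.Ventures.PercRepro2.GateFeedbackExitGeneral
import Summits.Ventures.PercRepro2.GateContract
import Summits.Ventures.PercRepro2.GateShadow
import Summits.Ventures.PercRepro2.GateSide
import Summits.Ventures.PercRepro2.GateSep
import Summits.Ventures.PercRepro2.GateNear
import Summits.Ventures.PercRepro2.GateRestrict

/-!
# Separator reductions and the near region for EVERY entry set `A` (blind cell PercRepro2,
mine-c g10; proofs/MINEC-FEEDBACK.md §11–§12, the `(GATE A,{w})` form)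

The class-`A₂` mass of the gadget `(A, {w})`, `massA₂ W = P(C(s) = W, w ∈ C(t), s ↮ t, C(s) ∩ A = ∅)`,
factorises exactly like the class-B mass (`massA₂_eq_connDel`), is symmetric in `(t, w)`
(`massA₂_comm`), transfers through a separator (`massA₂_eq_mul_of_sep`) and sees only the near
region (`massA₂_restrict`). Hence every theorem of `GateSep` / `GateRestrict` holds for every entry
set: `gateRow_general_of_sep_exit` / `_avoid` / `_two`, `gateRow_general_of_sep_exit_of_isForest_del_exit`,
`gateRow_general_of_sep_avoid_of_isForest_del`, `gateRow_general_of_isForest_near` / `_exit`.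
-/

namespace Summit.Ventures.PercRepro2

namespace GateSepGeneral

open scoped Classical

variable {V : Type*} {E : Type*} [Fintype E] [Fintype V]
variable {R : Type*} [Field R] [LinearOrder R] [IsStrictOrderedRing R]

/-! ## The class-`A₂` mass factorises in every graph -/

omit [LinearOrder R] [IsStrictOrderedRing R] in
/-- **The class-`A₂` mass in every graph**:
`massA₂ W = 1[t,w ∉ W, W ∩ A = ∅] · P(C(s) = W) · P(t ↔ w in G ∖ W)`. -/
theorem massA₂_eq_connDel (p : E → R) (ends : E → Sym2 V) (s t w : V) (A : Finset V)
    (W : Finset V) :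
    GateSplit.massA₂ p ends s t A {w} W =
      if t ∈ W ∨ w ∈ W ∨ ∃ x ∈ A, x ∈ W then 0 else
        prob p (clusterEvent ends s (↑W : Set V)) * prob p (connDelEvent ends W t w) := by
  unfold GateSplit.massA₂
  rw [show GateSplit.classA₂ ends s t A {w} =
      clusterInEvent ends t {W : Set V | w ∈ W} ∩ avoidAll ends s ({t} ∪ A) from by
    unfold GateSplit.classA₂; rw [GateSplitForest.hitsUW_singleton]]
  split_ifs with h
  · rw [show clusterEvent ends s (↑W : Set V) ∩
        (clusterInEvent ends t {W : Set V | w ∈ W} ∩ avoidAll ends s ({t} ∪ A)) = ∅ from ?_,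
      prob_empty]
    ext ω
    simp only [Set.mem_inter_iff, mem_clusterInEvent, Set.mem_setOf_eq, avoidAll,
      Set.mem_empty_iff_false, iff_false, not_and, mem_clusterEvent]
    intro hW hcw hav
    have hmem : ∀ v ∈ W, Conn ends ω s v := fun v hv => by
      have : v ∈ cluster ends ω s := by rw [hW]; exact Finset.mem_coe.2 hv
      exact this
    rcases h with h | h | ⟨x, hxA, hxW⟩
    · exact hav t (by simp) (hmem t h)
    · exact hav t (by simp) ((hmem w h).trans (conn_symm hcw))
    · exact hav x (Finset.mem_union_right _ hxA) (hmem x hxW)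
  · simp only [not_or, not_exists, not_and] at h
    obtain ⟨ht, hwW, hA⟩ := h
    have hset : clusterEvent ends s (↑W : Set V) ∩
        (clusterInEvent ends t {W : Set V | w ∈ W} ∩ avoidAll ends s ({t} ∪ A)) =
        clusterEvent ends s (↑W : Set V) ∩ connEvent ends t w := by
      ext ω
      simp only [Set.mem_inter_iff, mem_clusterInEvent, Set.mem_setOf_eq, avoidAll,
        mem_clusterEvent, connEvent]
      constructor
      · rintro ⟨hW, hcw, _⟩; exact ⟨hW, hcw⟩
      · rintro ⟨hW, hcw⟩
        refine ⟨hW, hcw, fun v hv hc => ?_⟩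
        have : v ∈ cluster ends ω s := hc
        rw [hW] at this
        rcases Finset.mem_union.1 hv with hv | hv
        · rw [Finset.mem_singleton] at hv
          subst hv
          exact ht (Finset.mem_coe.1 this)
        · exact hA v hv (Finset.mem_coe.1 this)
    rw [hset]
    exact prob_clusterEvent_inter_connEvent_eq_mul_connDel p ends s W ht

omit [LinearOrder R] [IsStrictOrderedRing R] in
/-- **The class-`A₂` mass is symmetric in the avoided vertex and the exit vertex.** -/
theorem massA₂_comm (p : E → R) (ends : E → Sym2 V) (s t w : V) (A : Finset V) :
    GateSplit.massA₂ p ends s t A {w} = GateSplit.massA₂ p ends s w A {t} := by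
  funext W
  rw [massA₂_eq_connDel, massA₂_eq_connDel, GateSep.connDelEvent_comm]
  have hiff : (t ∈ W ∨ w ∈ W ∨ ∃ x ∈ A, x ∈ W) ↔ (w ∈ W ∨ t ∈ W ∨ ∃ x ∈ A, x ∈ W) := by
    constructor
    · rintro (h | h | h)
      · exact Or.inr (Or.inl h)
      · exact Or.inl h
      · exact Or.inr (Or.inr h)
    · rintro (h | h | h)
      · exact Or.inr (Or.inl h)
      · exact Or.inl h
      · exact Or.inr (Or.inr h)
  by_cases h : t ∈ W ∨ w ∈ W ∨ ∃ x ∈ A, x ∈ W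
  · rw [if_pos h, if_pos (hiff.1 h)]
  · rw [if_neg h, if_neg (fun h' => h (hiff.2 h'))]

omit [IsStrictOrderedRing R] in
/-- The lattice condition is symmetric in the avoided vertex and the exit vertex. -/
theorem massA₂LogSupermod_comm {p : E → R} {ends : E → Sym2 V} {s t w : V} {A : Finset V}
    (h : GateSplit.MassA₂LogSupermod p ends s t A {w}) :
    GateSplit.MassA₂LogSupermod p ends s w A {t} := by
  intro W₁ W₂
  rw [← massA₂_comm]
  exact h W₁ W₂

/-! ## The separator reduction -/

section Reduction

variable {ends : E → Sym2 V}

omit [LinearOrder R] [IsStrictOrderedRing R] in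
/-- **THE SEPARATOR REDUCTION, every entry set.** If `z` separates `w` from `t` and the root is not
on `w`'s side, then `massA₂ (s,t,A,{w}) W = P(z ↔ w) · massA₂ (s,t,A,{z}) W` for every `W`. -/
theorem massA₂_eq_mul_of_sep (p : E → R) {s t w z : V} (A : Finset V)
    (hsep : w ∉ GateSide.side ends z t) (hside : w ∉ GateSide.side ends z s) (hwz : w ≠ z)
    (htz : t ≠ z) (W : Finset V) :
    GateSplit.massA₂ p ends s t A {w} W =
      prob p (connEvent ends z w) * GateSplit.massA₂ p ends s t A {z} W := by
  rw [massA₂_eq_connDel, massA₂_eq_connDel]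
  by_cases hz : z ∈ W
  · rw [if_pos (Or.inr (Or.inl hz)), mul_zero]
    split_ifs with h
    · rfl
    · simp only [not_or] at h
      have : connDelEvent ends W t w = ∅ := by
        ext ω
        simp only [Set.mem_empty_iff_false, iff_false]
        intro hω
        have := ((GateSide.mem_connDelEvent_iff_of_sep hsep W).1 hω).1
        exact not_conn_restrict_of_mem h.1 hz this
      rw [this, prob_empty, mul_zero]
  · by_cases hν : prob p (clusterEvent ends s (↑W : Set V)) = 0
    · rw [hν]
      simp
    · obtain ⟨ω₀, hω₀⟩ := GateFeedback.nonempty_of_prob_ne_zero hν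
      have hWs : ∀ v ∈ W, v ∈ GateSide.side ends z s := fun v hv =>
        GateSep.subset_side_of_clusterEvent hz hω₀ hv
      have hwW : w ∉ W := fun h => hside (hWs w h)
      simp only [hwW, hz, false_or]
      split_ifs with h
      · rw [mul_zero]
      · have hWw : ∀ v ∈ W, v ∉ GateSide.side ends z w := fun v hv hvw =>
          hside (GateSide.mem_side_trans (hWs v hv) (GateSide.mem_side_symm hvw))
        have key : prob p (connDelEvent ends W t w) =
            prob p (connDelEvent ends W t z) * prob p (connEvent ends z w) := by
          rw [← GateSide.prob_connDelEvent_inter_connEvent_of_sep p htz hwz hsep W]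
          congr 1
          ext ω
          rw [GateSide.mem_connDelEvent_iff_of_sep hsep W, Set.mem_inter_iff,
            GateSide.connDelEvent_eq_connEvent_of_side hwz hz hWw]
        rw [key]
        ring

/-- **The exit moves to a separator** (every entry set). -/
theorem massA₂LogSupermod_of_sep_exit {p : E → R} (hp : IsProbVec p) {s t w z : V} (A : Finset V)
    (hsep : w ∉ GateSide.side ends z t) (hside : w ∉ GateSide.side ends z s) (hwz : w ≠ z)
    (htz : t ≠ z) (h : GateSplit.MassA₂LogSupermod p ends s t A {z}) :
    GateSplit.MassA₂LogSupermod p ends s t A {w} := by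
  intro W₁ W₂
  rw [massA₂_eq_mul_of_sep p A hsep hside hwz htz W₁, massA₂_eq_mul_of_sep p A hsep hside hwz htz W₂,
    massA₂_eq_mul_of_sep p A hsep hside hwz htz (W₁ ∩ W₂),
    massA₂_eq_mul_of_sep p A hsep hside hwz htz (W₁ ∪ W₂)]
  have hc : 0 ≤ prob p (connEvent ends z w) := prob_nonneg hp _
  have := mul_le_mul_of_nonneg_left (h W₁ W₂) (mul_nonneg hc hc)
  calc prob p (connEvent ends z w) * GateSplit.massA₂ p ends s t A {z} W₁ *
        (prob p (connEvent ends z w) * GateSplit.massA₂ p ends s t A {z} W₂)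
      = prob p (connEvent ends z w) * prob p (connEvent ends z w) *
        (GateSplit.massA₂ p ends s t A {z} W₁ * GateSplit.massA₂ p ends s t A {z} W₂) := by ring
    _ ≤ prob p (connEvent ends z w) * prob p (connEvent ends z w) *
        (GateSplit.massA₂ p ends s t A {z} (W₁ ∩ W₂) *
          GateSplit.massA₂ p ends s t A {z} (W₁ ∪ W₂)) := this
    _ = _ := by ring

/-- **The avoided vertex moves to a separator** (every entry set). -/
theorem massA₂LogSupermod_of_sep_avoid {p : E → R} (hp : IsProbVec p) {s t w z : V}
    (A : Finset V) (hsep : t ∉ GateSide.side ends z w) (hside : t ∉ GateSide.side ends z s)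
    (htz : t ≠ z) (hwz : w ≠ z) (h : GateSplit.MassA₂LogSupermod p ends s z A {w}) :
    GateSplit.MassA₂LogSupermod p ends s t A {w} :=
  massA₂LogSupermod_comm
    (massA₂LogSupermod_of_sep_exit hp A hsep hside htz hwz (massA₂LogSupermod_comm h))

end Reduction

/-! ## The gate, every entry set -/

section Gate

variable {ends : E → Sym2 V}

/-- `(GATE A,{w})` at `w` from the lattice condition at a separator `z`. -/
theorem gateRow_general_of_sep_exit {p : E → R} (hp : IsProbVec p) (s t a b w z : V) (A : Finset V)
    (hsep : w ∉ GateSide.side ends z t) (hside : w ∉ GateSide.side ends z s) (hwz : w ≠ z)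
    (htz : t ≠ z) (h : GateSplit.MassA₂LogSupermod p ends s t A {z}) :
    Gate.GateRow p ends s {t} a b A {w} :=
  GateSplitForest.gateRow_of_massA₂_logSupermod p ends s t a b A {w} hp
    (massA₂LogSupermod_of_sep_exit hp A hsep hside hwz htz h)

/-- `(GATE A,{w})` at `t` from the lattice condition at a separator `z`. -/
theorem gateRow_general_of_sep_avoid {p : E → R} (hp : IsProbVec p) (s t a b w z : V)
    (A : Finset V) (hsep : t ∉ GateSide.side ends z w) (hside : t ∉ GateSide.side ends z s)
    (htz : t ≠ z) (hwz : w ≠ z) (h : GateSplit.MassA₂LogSupermod p ends s z A {w}) :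
    Gate.GateRow p ends s {t} a b A {w} :=
  GateSplitForest.gateRow_of_massA₂_logSupermod p ends s t a b A {w} hp
    (massA₂LogSupermod_of_sep_avoid hp A hsep hside htz hwz h)

/-- Two separators, every entry set. -/
theorem gateRow_general_of_sep_two {p : E → R} (hp : IsProbVec p) (s t a b w z₁ z₂ : V)
    (A : Finset V) (hsep₁ : w ∉ GateSide.side ends z₁ t) (hside₁ : w ∉ GateSide.side ends z₁ s)
    (hwz₁ : w ≠ z₁) (htz₁ : t ≠ z₁) (hsep₂ : t ∉ GateSide.side ends z₂ z₁)
    (hside₂ : t ∉ GateSide.side ends z₂ s) (htz₂ : t ≠ z₂) (hz₁z₂ : z₁ ≠ z₂)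
    (h : GateSplit.MassA₂LogSupermod p ends s z₂ A {z₁}) : Gate.GateRow p ends s {t} a b A {w} :=
  gateRow_general_of_sep_exit hp s t a b w z₁ A hsep₁ hside₁ hwz₁ htz₁
    (massA₂LogSupermod_of_sep_avoid hp A hsep₂ hside₂ htz₂ hz₁z₂ h)

/-- **Every cycle through the separator, every entry set**: `z` separates `w` from `t`, the root is
not beyond `z`, `G − z` is a forest. -/
theorem gateRow_general_of_sep_exit_of_isForest_del_exit {p : E → R} (hp : IsProbVec p)
    (s t a b w z : V) (A : Finset V) (hsep : w ∉ GateSide.side ends z t)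
    (hside : w ∉ GateSide.side ends z s) (hwz : w ≠ z) (htz : t ≠ z)
    (hF : Hull.IsForest (GateFeedback.endsF ends z)) : Gate.GateRow p ends s {t} a b A {w} :=
  gateRow_general_of_sep_exit hp s t a b w z A hsep hside hwz htz
    (GateFeedback.massA₂LogSupermod_of_isForest_del_exit hp A hF htz.symm)

/-- **Every cycle through the separator, avoided side, every entry set.** -/
theorem gateRow_general_of_sep_avoid_of_isForest_del {p : E → R} (hp : IsProbVec p)
    (s t a b w z : V) (A : Finset V) (hsep : t ∉ GateSide.side ends z w)
    (hside : t ∉ GateSide.side ends z s) (htz : t ≠ z) (hwz : w ≠ z)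
    (hF : Hull.IsForest (GateFeedback.endsF ends z)) : Gate.GateRow p ends s {t} a b A {w} :=
  gateRow_general_of_sep_avoid hp s t a b w z A hsep hside htz hwz
    (GateFeedback.massA₂LogSupermod_of_isForest_del hp A hF hwz)

end Gate

/-! ## The near region, every entry set -/

section Mass

attribute [local instance 2000] Classical.propDecidable

variable {ends : E → Sym2 V}

omit [LinearOrder R] [IsStrictOrderedRing R] in
/-- **`massA₂_G = massA₂_{G[near]}`** for the gadget `(A, {w})` (`s, t, w` distinct). -/
theorem massA₂_restrict (p : E → R) (s t w : V) (A : Finset V) (hst : s ≠ t) (hsw : s ≠ w)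
    (htw : t ≠ w) (W : Finset V) :
    GateSplit.massA₂ p ends s t A {w} W =
      GateSplit.massA₂ (GateNear.pR (GateNear.nearEdges ends s t w) p)
        (GateNear.endsR (GateNear.nearEdges ends s t w) ends) s t A {w} W := by
  have key := massA₂_eq_connDel (GateNear.pR (GateNear.nearEdges ends s t w) p)
    (GateNear.endsR (GateNear.nearEdges ends s t w) ends) s t w A W
  rw [massA₂_eq_connDel, key]
  split_ifs with h
  · rfl
  · simp only [not_or] at h
    obtain ⟨ht, hw, _⟩ := h
    by_cases hside : ∀ x ∈ W, x ∈ GateSide.side ends w s ∧ x ∈ GateSide.side ends t s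
    · have hWN : (↑W : Set V) ⊆ GateNear.near ends s t w := fun x hx =>
        GateNear.mem_near_of_sides (hside x (Finset.mem_coe.1 hx)).1
          (hside x (Finset.mem_coe.1 hx)).2
      have hcl : ∀ x ∈ W, ∀ y, (∃ e, ends e = s(x, y)) → y ∈ GateNear.near ends s t w := by
        intro x hx y hxy
        obtain ⟨e, hends⟩ := hxy
        by_cases hyt : y = t
        · rw [hyt]; exact GateNear.t_mem_near htw
        by_cases hyw : y = w
        · rw [hyw]; exact GateNear.w_mem_near htw
        exact GateNear.mem_near_of_sides
          (GateSide.mem_side_of_openAdj hsw (hside x hx).1 (ω := fun _ => true) ⟨e, rfl, hends⟩ hyw)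
          (GateSide.mem_side_of_openAdj hst (hside x hx).2 (ω := fun _ => true) ⟨e, rfl, hends⟩ hyt)
      rw [GateNear.clusterEvent_eq_preimage hWN hcl,
        GateNear.connDelEvent_eq_preimage hst hsw htw W,
        GateNear.prob_resF_preimage, GateNear.prob_resF_preimage]
      exact congrArg₂ (· * ·) (GateFeedback.prob_congr_inst _ _ _ _)
        (GateFeedback.prob_congr_inst _ _ _ _)
    · obtain ⟨x, hx, hxs⟩ : ∃ x ∈ W, ¬ (x ∈ GateSide.side ends w s ∧ x ∈ GateSide.side ends t s) := by
        by_contra hne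
        exact hside fun x hx => by_contra fun hc => hne ⟨x, hx, hc⟩
      have hG : clusterEvent ends s (↑W : Set V) = ∅ := by
        rw [Set.eq_empty_iff_forall_notMem]
        intro ω hω
        exact hxs ⟨GateSep.subset_side_of_clusterEvent hw hω hx,
          GateSep.subset_side_of_clusterEvent ht hω hx⟩
      have hmono : ∀ z x, GateSide.side (GateNear.endsR (GateNear.nearEdges ends s t w) ends)
          z x ⊆ GateSide.side ends z x := by
        intro z x v hv
        refine hv.mono ?_
        intro a b hab
        rw [openGraph_adj] at hab ⊢
        obtain ⟨hne, e, he, hends⟩ := hab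
        exact ⟨hne, ⟨e.1.1, e.2⟩, he, hends⟩
      have hF : clusterEvent (GateNear.endsR (GateNear.nearEdges ends s t w) ends) s
          (↑W : Set V) = ∅ := by
        rw [Set.eq_empty_iff_forall_notMem]
        intro σ hσ
        exact hxs ⟨hmono w s (GateSep.subset_side_of_clusterEvent hw hσ hx),
          hmono t s (GateSep.subset_side_of_clusterEvent ht hσ hx)⟩
      rw [hG, hF, prob_empty, prob_empty, zero_mul, zero_mul]

omit [IsStrictOrderedRing R] in
/-- The lattice condition of the near region is that of `G` (every entry set). -/
theorem massA₂LogSupermod_of_restrict {p : E → R} {s t w : V} {A : Finset V} (hst : s ≠ t)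
    (hsw : s ≠ w) (htw : t ≠ w)
    (h : GateSplit.MassA₂LogSupermod (GateNear.pR (GateNear.nearEdges ends s t w) p)
      (GateNear.endsR (GateNear.nearEdges ends s t w) ends) s t A {w}) :
    GateSplit.MassA₂LogSupermod p ends s t A {w} := by
  intro W₁ W₂
  rw [massA₂_restrict p s t w A hst hsw htw W₁, massA₂_restrict p s t w A hst hsw htw W₂,
    massA₂_restrict p s t w A hst hsw htw (W₁ ∩ W₂), massA₂_restrict p s t w A hst hsw htw (W₁ ∪ W₂)]
  exact h W₁ W₂

end Mass

section Theorem

attribute [local instance 2000] Classical.propDecidable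

variable {ends : E → Sym2 V}

/-- **THEOREM (the near region decides, every entry set).** If the edges inside the near region
not at `t` form a forest, `(GATE A,{w})` holds. -/
theorem gateRow_general_of_isForest_near {p : E → R} (hp : IsProbVec p) (s t a b w : V)
    (A : Finset V) (hst : s ≠ t) (hsw : s ≠ w) (htw : t ≠ w)
    (hF : Hull.IsForest (GateFeedback.endsF
      (GateNear.endsR (GateNear.nearEdges ends s t w) ends) t)) :
    Gate.GateRow p ends s {t} a b A {w} := by
  have h1 := GateFeedback.massA₂LogSupermod_of_isForest_del (s := s)
    (GateNear.IsProbVec.pR (GateNear.nearEdges ends s t w) hp) A hF htw.symm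
  have h2 := massA₂LogSupermod_of_restrict hst hsw htw h1
  exact GateSplitForest.gateRow_of_massA₂_logSupermod p ends s t a b A {w} hp h2

/-- **THEOREM (the near region decides, exit version, every entry set).** -/
theorem gateRow_general_of_isForest_near_exit {p : E → R} (hp : IsProbVec p) (s t a b w : V)
    (A : Finset V) (hst : s ≠ t) (hsw : s ≠ w) (htw : t ≠ w)
    (hF : Hull.IsForest (GateFeedback.endsF
      (GateNear.endsR (GateNear.nearEdges ends s t w) ends) w)) :
    Gate.GateRow p ends s {t} a b A {w} := by
  have h1 := GateFeedback.massA₂LogSupermod_of_isForest_del_exit (s := s)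
    (GateNear.IsProbVec.pR (GateNear.nearEdges ends s t w) hp) A hF htw.symm
  have h2 := massA₂LogSupermod_of_restrict hst hsw htw h1
  exact GateSplitForest.gateRow_of_massA₂_logSupermod p ends s t a b A {w} hp h2

end Theorem

end GateSepGeneral

end Summit.Ventures.PercRepro2
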